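import Literature.MathematicalPhysics.KineticTheory.LangevinChainScalingLimit
import Literature.MathematicalPhysics.KineticTheory.LangevinChainConfined
import Literature.Analysis.ODE.ForceTracking
import HarnessLib

/-!
# Approximate controllability of an anharmonic chain driven by one force at its end

Trunk T-KINETIC (Literature/MathematicalPhysics/KineticTheory). The deterministic control problem
behind the irreducibility of heat-conduction chains (Rey-Bellet–Thomas 2002, Prop. 4.2;
Eckmann–Pillet–Rey-Bellet 1999, Thm 3.2): the chain
`q̇_i = p_i`, `ṗ_i = -∂_{q_i}Φ(q) + [i = 0] φ(t)`, `Φ(q) = ∑ U(q_i) + ∑ V(q_{i+1} - q_i)`,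
with ONE continuous force `φ` acting on the end site `0`, is APPROXIMATELY CONTROLLABLE on every
time interval `[0, T]`: from every state every neighbourhood of every state is reached at time
`T` by a suitable `φ`. The only hypothesis on the interaction beyond smoothness is that
`V' : ℝ → ℝ` is ONTO (no convexity, no non-degeneracy) — the neighbour `q_0` acts on `q_1` only
through the force `-V'(q_1 - q_0)`, and a prescribed continuous force profile can be followed
in `L¹` by a smooth relative position (`Literature/Analysis/ODE/ForceTracking.lean`), which is all
the driven site sees up to a uniformly small error (Grönwall).

* `OscillatorChain.chainField m` — the Hamiltonian vector field `(p, -∇Φ(q))` on `PhaseSpace m`;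
  `forceDir m = (0, e_0)`, `chainForcing m x₀ φ t = x₀ + (∫₀ᵗ φ) • forceDir m` — the forcing path
  of the integral equation `z(t) = g(t) + ∫₀ᵗ X(z)` (`Literature.Analysis.ODE.IsIntegralSolutionOn`);
* `IsIntegralSolutionOn.exists_near_of_forcing` — **robustness**: a solution on `[0, T]` of
  `z = g + ∫ F(z)` (`F ∈ C¹`, finite dimension) persists, uniformly close, under every uniformly
  small continuous perturbation of the forcing (truncation + Picard + Grönwall);
* `OscillatorChain.dPotential_cons_zero`, `dPotential_cons_succ` — peeling the end site:
  `∂_0Φ_{m+2}(a :: q') = U'(a) - V'(q'_0 - a)`, `∂_{i+1}Φ_{m+2}(a :: q') = ∂_iΦ_{m+1}(q') + [i = 0] V'(q'_0 - a)`;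
* `OscillatorChain.chain_approxControl` — **approximate controllability**: for `U, V ∈ C²` with
  `V'` onto, every `m`, `T > 0`, `x₀, x_T ∈ PhaseSpace (m+1)` and `ε > 0` there are a continuous
  force `φ` and a continuous solution `z` of the forced chain from `x₀` with `dist (z T) x_T ≤ ε`
  (induction on `m`: the tail chain is steered by the induction hypothesis, the bond force
  `-V'(q_1 - q_0)` tracks the required force in `L¹` with the end jets of `q_1 - q_0` prescribed,
  and the end site follows `q_0 = q_1 - y`).

## References

* L. Rey-Bellet, L. E. Thomas, Comm. Math. Phys. **225** (2002) 305–329, Prop. 4.2.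
* J.-P. Eckmann, C.-A. Pillet, L. Rey-Bellet, J. Stat. Phys. **95** (1999) 305–331, Thm 3.2;
  Comm. Math. Phys. **201** (1999) 657–697, §3.
* V. Jurdjevic, *Geometric Control Theory* (1997), Ch. 5 (controllability of mechanical chains).
  [folklore]
-/

noncomputable section

open MeasureTheory Set Filter Topology intervalIntegral Metric
open scoped NNReal

namespace Literature.MathematicalPhysics.KineticTheory

open Literature.Analysis.ODE

/-! ### Robustness of a solution of a forced integral equation -/

section Robust

variable {E : Type*} [NormedAddCommGroup E] [NormedSpace ℝ E] [FiniteDimensional ℝ E]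
  [CompleteSpace E]

omit [FiniteDimensional ℝ E] [CompleteSpace E] in
/-- Changing the field along the solution does not matter. [folklore] -/
theorem _root_.Literature.Analysis.ODE.IsIntegralSolutionOn.congr_field {F F' : E → E}
    {g z : ℝ → E} {T : ℝ} (h : IsIntegralSolutionOn F g z T)
    (hFF' : ∀ t ∈ Icc 0 T, F' (z t) = F (z t)) : IsIntegralSolutionOn F' g z T := by
  intro t ht
  rw [h t ht]
  congr 1
  refine intervalIntegral.integral_congr fun s hs => ?_
  rw [uIcc_of_le ht.1] at hs
  exact (hFF' s ⟨hs.1, hs.2.trans ht.2⟩).symm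

/-- **Robustness of a solution under small perturbations of the forcing.** Let `F ∈ C¹` on a
finite-dimensional space and let `z` be a continuous solution of `z = g + ∫₀ F(z)` on `[0, T]`.
For every `ε > 0` there is `δ > 0` such that every continuous forcing `g'` with
`sup_{[0,T]} ‖g' - g‖ ≤ δ` admits a continuous solution `z'` on `[0, T]` with
`sup_{[0,T]} ‖z' - z‖ ≤ ε`: solve the equation with the field truncated outside the ball of
radius `sup ‖z‖ + 1` (globally Lipschitz, Picard), compare with `z` by Grönwall, and observe that
the new solution stays in that ball, where the truncation is invisible. [folklore] -/
theorem _root_.Literature.Analysis.ODE.IsIntegralSolutionOn.exists_near_of_forcing {F : E → E}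
    (hF : ContDiff ℝ 1 F) {g z : ℝ → E} {T : ℝ} (hz : IsIntegralSolutionOn F g z T)
    (hzc : Continuous z) {ε : ℝ} (hε : 0 < ε) :
    ∃ δ : ℝ, 0 < δ ∧ ∀ g' : ℝ → E, Continuous g' → (∀ t ∈ Icc 0 T, ‖g' t - g t‖ ≤ δ) →
      ∃ z' : ℝ → E, Continuous z' ∧ IsIntegralSolutionOn F g' z' T ∧
        ∀ t ∈ Icc 0 T, ‖z' t - z t‖ ≤ ε := by
  -- a bound for `z` on `[0, T]` and the truncation radius
  obtain ⟨B, hB⟩ := isCompact_Icc.exists_bound_of_continuousOn (hzc.continuousOn (s := Icc 0 T))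
  set R : ℝ := max B 0 + 1 with hR
  have hR0 : 0 < R := by positivity
  obtain ⟨K, hK⟩ := exists_lipschitzWith_truncateField hF hR0
  set ε' : ℝ := min ε 1 with hε'
  have hε'0 : 0 < ε' := lt_min hε one_pos
  set δ : ℝ := ε' * Real.exp (-(K * max T 0)) with hδ
  have hδ0 : 0 < δ := mul_pos hε'0 (Real.exp_pos _)
  refine ⟨δ, hδ0, fun g' hg'c hg' => ?_⟩
  -- `z` solves the truncated equation
  have hzR : ∀ t ∈ Icc 0 T, ‖z t‖ ≤ R := fun t ht =>
    ((hB t ht).trans (le_max_left _ _)).trans (le_add_of_nonneg_right zero_le_one)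
  have hzT : IsIntegralSolutionOn (truncateField R F) g z T :=
    hz.congr_field fun t ht => truncateField_of_norm_le hR0 F (hzR t ht)
  -- the Picard solution of the truncated equation with the new forcing
  set z' : ℝ → E := forcedSolution (truncateField R F) g' with hz'
  have hz'c : Continuous z' := continuous_forcedSolution hK hg'c
  have hz'T : IsIntegralSolutionOn (truncateField R F) g' z' T :=
    isIntegralSolutionOn_forcedSolution hK hg'c T
  -- Grönwall
  have hclose : ∀ t ∈ Icc 0 T, ‖z' t - z t‖ ≤ ε' := by
    intro t ht
    have h := IsIntegralSolutionOn.norm_sub_le_mul_exp hK.lipschitzOnWith hz'T hzT hz'c hzc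
      (fun _ _ => mem_univ _) (fun _ _ => mem_univ _) hg' t ht
    refine h.trans ?_
    rw [hδ, mul_assoc, ← Real.exp_add]
    have : -(K * max T 0) + K * t ≤ 0 := by
      have := mul_le_mul_of_nonneg_left (le_max_left T 0 |> ht.2.trans) K.coe_nonneg
      linarith
    calc ε' * Real.exp (-(↑K * max T 0) + ↑K * t) ≤ ε' * 1 :=
          mul_le_mul_of_nonneg_left (Real.exp_le_one_iff.2 this) hε'0.le
      _ = ε' := mul_one _
  -- the new solution stays in the ball, so it solves the untruncated equation
  have hz'R : ∀ t ∈ Icc 0 T, ‖z' t‖ ≤ R := by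
    intro t ht
    have h1 := hclose t ht
    have h2 : ‖z t‖ ≤ max B 0 := (hB t ht).trans (le_max_left _ _)
    calc ‖z' t‖ = ‖(z' t - z t) + z t‖ := by rw [sub_add_cancel]
      _ ≤ ‖z' t - z t‖ + ‖z t‖ := norm_add_le _ _
      _ ≤ ε' + max B 0 := add_le_add h1 h2
      _ ≤ 1 + max B 0 := add_le_add (min_le_right _ _) le_rfl
      _ = R := by rw [hR]; ring
  refine ⟨z', hz'c, hz'T.congr_field fun t ht => (truncateField_of_norm_le hR0 F (hz'R t ht)).symm,
    fun t ht => (hclose t ht).trans (min_le_left _ _)⟩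

end Robust

end Literature.MathematicalPhysics.KineticTheory

namespace Literature.MathematicalPhysics.KineticTheory.HeatConduction

open Literature.Analysis.ODE Literature.MathematicalPhysics.KineticTheory

/-! ### Peeling the end site: `Fin.cons` bookkeeping on phase space -/

/-- Prepend a site `(a, b) = (q_0, p_0)` to a state of the `(m+1)`-chain. [folklore] -/
def consPS {m : ℕ} (c : ℝ × ℝ) (z : PhaseSpace (m + 1)) : PhaseSpace (m + 2) :=
  (Fin.cons c.1 z.1, Fin.cons c.2 z.2)

/-- Drop the end site `0`. [folklore] -/
def tailPS {m : ℕ} (z : PhaseSpace (m + 2)) : PhaseSpace (m + 1) :=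
  (Fin.tail z.1, Fin.tail z.2)

/-- Position of the prepended site. [folklore] -/
@[simp] theorem consPS_fst_zero {m : ℕ} (c : ℝ × ℝ) (z : PhaseSpace (m + 1)) :
    (consPS c z).1 0 = c.1 := rfl

/-- Momentum of the prepended site. [folklore] -/
@[simp] theorem consPS_snd_zero {m : ℕ} (c : ℝ × ℝ) (z : PhaseSpace (m + 1)) :
    (consPS c z).2 0 = c.2 := rfl

/-- Positions of the tail. [folklore] -/
@[simp] theorem consPS_fst_succ {m : ℕ} (c : ℝ × ℝ) (z : PhaseSpace (m + 1)) (i : Fin (m + 1)) :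
    (consPS c z).1 i.succ = z.1 i := by simp [consPS]

/-- Momenta of the tail. [folklore] -/
@[simp] theorem consPS_snd_succ {m : ℕ} (c : ℝ × ℝ) (z : PhaseSpace (m + 1)) (i : Fin (m + 1)) :
    (consPS c z).2 i.succ = z.2 i := by simp [consPS]

/-- Positions of the tail. [folklore] -/
@[simp] theorem tailPS_fst {m : ℕ} (z : PhaseSpace (m + 2)) (i : Fin (m + 1)) :
    (tailPS z).1 i = z.1 i.succ := rfl

/-- Momenta of the tail. [folklore] -/
@[simp] theorem tailPS_snd {m : ℕ} (z : PhaseSpace (m + 2)) (i : Fin (m + 1)) :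
    (tailPS z).2 i = z.2 i.succ := rfl

/-- Prepending the end site to the tail recovers the state. [folklore] -/
theorem consPS_tailPS {m : ℕ} (z : PhaseSpace (m + 2)) :
    consPS (z.1 0, z.2 0) (tailPS z) = z := by
  refine Prod.ext ?_ ?_ <;> simp [consPS, tailPS, Fin.cons_self_tail]

/-- The sup norm of a `Fin.cons` vector. [folklore] -/
theorem norm_finCons_le_iff {m : ℕ} (a : ℝ) (f : Fin (m + 1) → ℝ) {r : ℝ} (hr : 0 ≤ r) :
    ‖(Fin.cons a f : Fin (m + 2) → ℝ)‖ ≤ r ↔ |a| ≤ r ∧ ‖f‖ ≤ r := by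
  rw [pi_norm_le_iff_of_nonneg hr, Fin.forall_fin_succ, pi_norm_le_iff_of_nonneg hr]
  simp only [Fin.cons_zero, Fin.cons_succ, Real.norm_eq_abs]

/-- Distance of two states with the same peeling: `dist ≤ r` iff the end sites and the tails are
`r`-close. [folklore] -/
theorem dist_consPS_le {m : ℕ} {c c' : ℝ × ℝ} {z z' : PhaseSpace (m + 1)} {r : ℝ} (hr : 0 ≤ r)
    (h1 : |c.1 - c'.1| ≤ r) (h2 : |c.2 - c'.2| ≤ r) (h3 : dist z z' ≤ r) :
    dist (consPS c z) (consPS c' z') ≤ r := by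
  rw [dist_eq_norm, Prod.norm_def, max_le_iff]
  rw [dist_eq_norm, Prod.norm_def, max_le_iff] at h3
  have e1 : (consPS c z - consPS c' z').1 = Fin.cons (c.1 - c'.1) (z.1 - z'.1) := by
    ext i; refine Fin.cases ?_ (fun j => ?_) i <;> simp [consPS]
  have e2 : (consPS c z - consPS c' z').2 = Fin.cons (c.2 - c'.2) (z.2 - z'.2) := by
    ext i; refine Fin.cases ?_ (fun j => ?_) i <;> simp [consPS]
  rw [e1, e2, norm_finCons_le_iff _ _ hr, norm_finCons_le_iff _ _ hr]
  exact ⟨⟨h1, h3.1⟩, ⟨h2, h3.2⟩⟩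

/-- `consPS` of continuous data is continuous. [folklore] -/
theorem continuous_consPS {m : ℕ} {c : ℝ → ℝ × ℝ} {z : ℝ → PhaseSpace (m + 1)} (hc : Continuous c)
    (hz : Continuous z) : Continuous fun t => consPS (c t) (z t) := by
  unfold consPS
  exact ((continuous_fst.comp hc).finCons (continuous_fst.comp hz)).prodMk
    ((continuous_snd.comp hc).finCons (continuous_snd.comp hz))

namespace OscillatorChain

variable (P : OscillatorChain)

/-! ### The chain vector field and its forcing at the end site -/

/-- The **Hamiltonian vector field of the `m`-site chain** `(q, p) ↦ (p, -∇Φ(q))`,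
`∂Φ/∂q_i = dPotential`. [folklore] -/
def chainField (m : ℕ) (z : PhaseSpace m) : PhaseSpace m :=
  (z.2, fun i => -P.dPotential m i z.1)

/-- The direction `(0, e_0)` of a force on the end site `0`. [folklore] -/
def forceDir (m : ℕ) : PhaseSpace (m + 1) :=
  (0, Pi.single 0 1)

/-- The **forcing path** of the integral equation of the chain driven by the force profile `φ`
at site `0` from `x₀`: `g(t) = x₀ + (∫₀ᵗ φ) • (0, e_0)`. [folklore] -/
def chainForcing (m : ℕ) (x₀ : PhaseSpace (m + 1)) (φ : ℝ → ℝ) (t : ℝ) : PhaseSpace (m + 1) :=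
  x₀ + (∫ s in (0 : ℝ)..t, φ s) • forceDir m

/-- The position component of the chain field is the momentum. [folklore] -/
@[simp] theorem chainField_fst (m : ℕ) (z : PhaseSpace m) : (P.chainField m z).1 = z.2 := rfl

/-- The momentum component of the chain field is the force. [folklore] -/
@[simp] theorem chainField_snd (m : ℕ) (z : PhaseSpace m) (i : Fin m) :
    (P.chainField m z).2 i = -P.dPotential m i z.1 := rfl

/-- The force direction has no position component. [folklore] -/
@[simp] theorem forceDir_fst (m : ℕ) : (forceDir m).1 = 0 := rfl

/-- The force direction acts on site `0`. [folklore] -/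
@[simp] theorem forceDir_snd_zero (m : ℕ) : (forceDir m).2 0 = 1 := by simp [forceDir]

/-- The force direction does not act on the tail. [folklore] -/
@[simp] theorem forceDir_snd_succ (m : ℕ) (i : Fin m) : (forceDir m).2 i.succ = 0 := by
  simp [forceDir, Fin.succ_ne_zero]

/-- The force direction is a unit vector. [folklore] -/
theorem norm_forceDir (m : ℕ) : ‖forceDir m‖ = 1 := by
  rw [forceDir, Prod.norm_def, norm_zero, Pi.norm_single, norm_one, max_eq_right zero_le_one]

/-- The forcing path has constant position components. [folklore] -/
@[simp] theorem chainForcing_fst (m : ℕ) (x₀ : PhaseSpace (m + 1)) (φ : ℝ → ℝ) (t : ℝ) (i : Fin (m + 1)) :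
    (chainForcing m x₀ φ t).1 i = x₀.1 i := by simp [chainForcing]

/-- The forcing path at site `0`: the primitive of the force. [folklore] -/
@[simp] theorem chainForcing_snd_zero (m : ℕ) (x₀ : PhaseSpace (m + 1)) (φ : ℝ → ℝ) (t : ℝ) :
    (chainForcing m x₀ φ t).2 0 = x₀.2 0 + ∫ s in (0 : ℝ)..t, φ s := by simp [chainForcing]

/-- The forcing path is constant on the tail momenta. [folklore] -/
@[simp] theorem chainForcing_snd_succ (m : ℕ) (x₀ : PhaseSpace (m + 1)) (φ : ℝ → ℝ) (t : ℝ)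
    (i : Fin m) : (chainForcing m x₀ φ t).2 i.succ = x₀.2 i.succ := by simp [chainForcing]

/-- The forcing path is constant on the momenta of the sites `j ≠ 0`. [folklore] -/
theorem chainForcing_snd_of_ne_zero (m : ℕ) (x₀ : PhaseSpace (m + 1)) (φ : ℝ → ℝ) (t : ℝ)
    {j : Fin (m + 1)} (hj : j ≠ 0) : (chainForcing m x₀ φ t).2 j = x₀.2 j := by
  simp [chainForcing, forceDir, Pi.single_eq_of_ne hj]

/-- The forcing path is continuous for a continuous force profile. [folklore] -/
theorem continuous_chainForcing (m : ℕ) (x₀ : PhaseSpace (m + 1)) {φ : ℝ → ℝ} (hφ : Continuous φ) :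
    Continuous (chainForcing m x₀ φ) := by
  unfold chainForcing
  exact continuous_const.add
    ((intervalIntegral.continuous_primitive (fun _ _ => hφ.intervalIntegrable _ _) 0).smul
      continuous_const)

/-- Two forcing paths from the same point differ by the primitives of the force profiles.
[folklore] -/
theorem norm_chainForcing_sub (m : ℕ) (x₀ : PhaseSpace (m + 1)) (φ ψ : ℝ → ℝ) (t : ℝ) :
    ‖chainForcing m x₀ φ t - chainForcing m x₀ ψ t‖ =
      |(∫ s in (0 : ℝ)..t, φ s) - ∫ s in (0 : ℝ)..t, ψ s| := by
  unfold chainForcing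
  rw [add_sub_add_left_eq_sub, ← sub_smul, norm_smul, norm_forceDir, mul_one, Real.norm_eq_abs]

variable {P}

/-- The chain field is `C¹` for `C²` potentials. [folklore] -/
theorem contDiff_chainField (hU : ContDiff ℝ 2 P.U) (hV : ContDiff ℝ 2 P.V) (m : ℕ) :
    ContDiff ℝ 1 (P.chainField m) := by
  have h2 : (2 : WithTop ℕ∞) = 1 + 1 := by norm_num
  rw [h2] at hU hV
  refine contDiff_snd.prodMk (contDiff_pi.2 fun i => ?_)
  exact ((P.contDiff_dPotential_of_succ hU hV m i).comp contDiff_fst).neg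

/-- The chain field is continuous for `C²` potentials. [folklore] -/
theorem continuous_chainField (hU : ContDiff ℝ 2 P.U) (hV : ContDiff ℝ 2 P.V) (m : ℕ) :
    Continuous (P.chainField m) :=
  (contDiff_chainField hU hV m).continuous

/-- `∂Φ/∂q_i` is continuous for `C²` potentials. [folklore] -/
theorem continuous_dPotential (hU : ContDiff ℝ 2 P.U) (hV : ContDiff ℝ 2 P.V) (m : ℕ) (i : Fin m) :
    Continuous (P.dPotential m i) := by
  have h2 : (2 : WithTop ℕ∞) = 1 + 1 := by norm_num
  rw [h2] at hU hV
  exact (P.contDiff_dPotential_of_succ hU hV m i).continuous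

/-! ### Peeling the end site off `∂Φ/∂q` -/

variable (P) in
/-- **The force on the end site**: `∂_0Φ_{m+2}(a :: q') = U'(a) - V'(q'_0 - a)`. [folklore] -/
theorem dPotential_cons_zero (m : ℕ) (a : ℝ) (q' : Fin (m + 1) → ℝ) :
    P.dPotential (m + 2) 0 (Fin.cons a q') = deriv P.U a - deriv P.V (q' 0 - a) := by
  rw [P.dPotential_eq_closed]
  have h1 : ¬ (0 < (0 : Fin (m + 2)).val) := by simp
  have h2 : (0 : Fin (m + 2)).val + 1 < m + 2 := by simp
  rw [dif_neg h1, dif_pos h2]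
  have h3 : (⟨(0 : Fin (m + 2)).val + 1, h2⟩ : Fin (m + 2)) = Fin.succ 0 := rfl
  rw [h3, Fin.cons_succ, Fin.cons_zero]
  ring

variable (P) in
/-- **The forces on the tail**: `∂_{i+1}Φ_{m+2}(a :: q') = ∂_iΦ_{m+1}(q') + [i = 0] V'(q'_0 - a)`
(only the first tail site feels the peeled bond). [folklore] -/
theorem dPotential_cons_succ (m : ℕ) (a : ℝ) (q' : Fin (m + 1) → ℝ) (i : Fin (m + 1)) :
    P.dPotential (m + 2) i.succ (Fin.cons a q') =
      P.dPotential (m + 1) i q' + if i.val = 0 then deriv P.V (q' 0 - a) else 0 := by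
  rw [P.dPotential_eq_closed, P.dPotential_eq_closed]
  -- the right bond
  have hr : (if h : (i.succ : Fin (m + 2)).val + 1 < m + 2 then
        deriv P.V ((Fin.cons a q' : Fin (m + 2) → ℝ) ⟨(i.succ : Fin (m + 2)).val + 1, h⟩ -
          (Fin.cons a q' : Fin (m + 2) → ℝ) i.succ) else 0) =
      (if h : i.val + 1 < m + 1 then deriv P.V (q' ⟨i.val + 1, h⟩ - q' i) else 0) := by
    by_cases h : i.val + 1 < m + 1
    · have h' : (i.succ : Fin (m + 2)).val + 1 < m + 2 := by simp; omega
      rw [dif_pos h', dif_pos h]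
      have he : (⟨(i.succ : Fin (m + 2)).val + 1, h'⟩ : Fin (m + 2)) = Fin.succ ⟨i.val + 1, h⟩ :=
        Fin.ext (by simp)
      rw [he, Fin.cons_succ, Fin.cons_succ]
    · have h' : ¬ ((i.succ : Fin (m + 2)).val + 1 < m + 2) := by simp; omega
      rw [dif_neg h', dif_neg h]
  rw [hr, Fin.cons_succ]
  -- the left bond
  have hl0 : 0 < (i.succ : Fin (m + 2)).val := by simp
  rw [dif_pos hl0]
  by_cases hi : i.val = 0
  · have hi' : i = 0 := Fin.ext hi
    subst hi'
    have he : (⟨(Fin.succ (0 : Fin (m + 1)) : Fin (m + 2)).val - 1, by simp⟩ : Fin (m + 2)) = 0 :=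
      Fin.ext (by simp)
    rw [he, Fin.cons_zero, dif_neg (show ¬ (0 < (0 : Fin (m + 1)).val) by simp),
      if_pos (show (0 : Fin (m + 1)).val = 0 by simp)]
    ring
  · have hipos : 0 < i.val := Nat.pos_of_ne_zero hi
    rw [dif_pos hipos, if_neg hi]
    have he : (⟨(i.succ : Fin (m + 2)).val - 1, by simp; omega⟩ : Fin (m + 2)) =
        Fin.succ ⟨i.val - 1, by omega⟩ := Fin.ext (by simp; omega)
    rw [he, Fin.cons_succ]
    ring

/-! ### Componentwise form of the integral equation -/

/-- The integral of a continuous phase-space-valued path, read componentwise. [folklore] -/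
theorem integral_phaseSpace_apply {m : ℕ} {f : ℝ → PhaseSpace m} (hf : Continuous f) (a b : ℝ) :
    ((∫ s in a..b, f s).1 = fun i => ∫ s in a..b, (f s).1 i) ∧
      ((∫ s in a..b, f s).2 = fun i => ∫ s in a..b, (f s).2 i) := by
  have hfi : IntervalIntegrable f volume a b := hf.intervalIntegrable _ _
  constructor
  · funext i
    have h := (((ContinuousLinearMap.proj (R := ℝ) (φ := fun _ : Fin m => ℝ) i).comp
      (ContinuousLinearMap.fst ℝ (Fin m → ℝ) (Fin m → ℝ))).intervalIntegral_comp_comm hfi)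
    simpa using h.symm
  · funext i
    have h := (((ContinuousLinearMap.proj (R := ℝ) (φ := fun _ : Fin m => ℝ) i).comp
      (ContinuousLinearMap.snd ℝ (Fin m → ℝ) (Fin m → ℝ))).intervalIntegral_comp_comm hfi)
    simpa using h.symm

/-- **The integral equation of the forced chain, componentwise**: a continuous `z` solves
`z(t) = g(t) + ∫₀ᵗ X(z)` on `[0, T]` iff `q_i(t) = g_q,i(t) + ∫₀ᵗ p_i` and
`p_i(t) = g_p,i(t) - ∫₀ᵗ ∂_iΦ(q)` for all `i`. [folklore] -/
theorem isIntegralSolutionOn_chain_iff (hU : ContDiff ℝ 2 P.U) (hV : ContDiff ℝ 2 P.V) {m : ℕ}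
    {g z : ℝ → PhaseSpace m} (hz : Continuous z) {T : ℝ} :
    IsIntegralSolutionOn (P.chainField m) g z T ↔
      (∀ t ∈ Icc 0 T, ∀ i, (z t).1 i = (g t).1 i + ∫ s in (0 : ℝ)..t, (z s).2 i) ∧
      (∀ t ∈ Icc 0 T, ∀ i, (z t).2 i = (g t).2 i - ∫ s in (0 : ℝ)..t, P.dPotential m i (z s).1) := by
  have hc : Continuous fun s => P.chainField m (z s) := (continuous_chainField hU hV m).comp hz
  have key : ∀ t, ((∫ s in (0 : ℝ)..t, P.chainField m (z s)).1 = fun i => ∫ s in (0 : ℝ)..t, (z s).2 i) ∧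
      ((∫ s in (0 : ℝ)..t, P.chainField m (z s)).2 =
        fun i => -∫ s in (0 : ℝ)..t, P.dPotential m i (z s).1) := by
    intro t
    obtain ⟨h1, h2⟩ := integral_phaseSpace_apply hc 0 t
    refine ⟨by rw [h1]; rfl, ?_⟩
    rw [h2]
    funext i
    simp only [chainField_snd, intervalIntegral.integral_neg]
  constructor
  · intro h
    refine ⟨fun t ht i => ?_, fun t ht i => ?_⟩
    · have := congrArg (fun w : PhaseSpace m => w.1 i) (h t ht)
      simp only [Prod.fst_add, Pi.add_apply] at this
      rw [this, (key t).1]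
    · have := congrArg (fun w : PhaseSpace m => w.2 i) (h t ht)
      simp only [Prod.snd_add, Pi.add_apply] at this
      rw [this, (key t).2, sub_eq_add_neg]
  · rintro ⟨h1, h2⟩ t ht
    refine Prod.ext (funext fun i => ?_) (funext fun i => ?_)
    · rw [Prod.fst_add, Pi.add_apply, (key t).1, h1 t ht i]
    · rw [Prod.snd_add, Pi.add_apply, (key t).2, h2 t ht i, sub_eq_add_neg]

/-! ### Calculus helpers for `C²` paths -/

/-- A `C²` function has a `C¹` derivative. [folklore] -/
theorem contDiff_one_deriv_of_two {y : ℝ → ℝ} (hy : ContDiff ℝ 2 y) : ContDiff ℝ 1 (deriv y) := by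
  have h2 : (2 : WithTop ℕ∞) = 1 + 1 := by norm_num
  rw [h2] at hy
  exact hy.deriv'

/-- The second derivative of a `C²` function is continuous. [folklore] -/
theorem continuous_deriv_deriv_of_two {y : ℝ → ℝ} (hy : ContDiff ℝ 2 y) :
    Continuous (deriv (deriv y)) := by
  have h1 := contDiff_one_deriv_of_two hy
  have h1' : (1 : WithTop ℕ∞) = 0 + 1 := by norm_num
  rw [h1'] at h1
  exact (h1.deriv').continuous

/-- FTC for a `C²` path: `∫₀ᵗ y' = y t - y 0`. [folklore] -/
theorem integral_deriv_of_two {y : ℝ → ℝ} (hy : ContDiff ℝ 2 y) (t : ℝ) :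
    ∫ s in (0 : ℝ)..t, deriv y s = y t - y 0 :=
  intervalIntegral.integral_deriv_eq_sub (fun s _ => (hy.differentiable (by norm_num)) s)
    ((contDiff_one_deriv_of_two hy).continuous.intervalIntegrable _ _)

/-- FTC for the derivative of a `C²` path: `∫₀ᵗ y'' = y' t - y' 0`. [folklore] -/
theorem integral_deriv_deriv_of_two {y : ℝ → ℝ} (hy : ContDiff ℝ 2 y) (t : ℝ) :
    ∫ s in (0 : ℝ)..t, deriv (deriv y) s = deriv y t - deriv y 0 :=
  intervalIntegral.integral_deriv_eq_sub
    (fun s _ => ((contDiff_one_deriv_of_two hy).differentiable one_ne_zero) s)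
    ((continuous_deriv_deriv_of_two hy).intervalIntegrable _ _)

/-- The derivative of a `C²` potential is continuous. [folklore] -/
theorem continuous_deriv_of_two {W : ℝ → ℝ} (hW : ContDiff ℝ 2 W) : Continuous (deriv W) :=
  (contDiff_one_deriv_of_two hW).continuous

/-! ### Approximate controllability -/

/-- **One site is exactly controllable**: `q̈ = -U'(q) + φ` follows any `C²` path, in
particular one with prescribed position and velocity at `0` and `T` (a path from
`exists_contDiff_forceTracking` with `w = id`). [folklore] -/
theorem chain_approxControl_zero (hU : ContDiff ℝ 2 P.U) (hV : ContDiff ℝ 2 P.V) {T : ℝ}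
    (hT : 0 < T) (x₀ xT : PhaseSpace 1) {ε : ℝ} (hε : 0 < ε) :
    ∃ φ : ℝ → ℝ, Continuous φ ∧ ∃ z : ℝ → PhaseSpace 1, Continuous z ∧
      IsIntegralSolutionOn (P.chainField 1) (chainForcing 0 x₀ φ) z T ∧ dist (z T) xT ≤ ε := by
  obtain ⟨y, hy, hy0, hy0', hyT, hyT', -, -⟩ := exists_contDiff_forceTracking continuous_id
    Function.surjective_id hT (continuousOn_const (c := (0 : ℝ))) (x₀.1 0) (x₀.2 0) (xT.1 0)
    (xT.2 0) one_pos
  have hyc : Continuous y := hy.continuous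
  have hy'c : Continuous (deriv y) := (contDiff_one_deriv_of_two hy).continuous
  have hy''c : Continuous (deriv (deriv y)) := continuous_deriv_deriv_of_two hy
  set z : ℝ → PhaseSpace 1 := fun t => (fun _ => y t, fun _ => deriv y t) with hz
  have hzc : Continuous z :=
    (continuous_pi fun _ => hyc).prodMk (continuous_pi fun _ => hy'c)
  set φ : ℝ → ℝ := fun t => deriv (deriv y) t + P.dPotential 1 0 (fun _ => y t) with hφ
  have hPc : Continuous fun t => P.dPotential 1 0 (fun _ : Fin 1 => y t) :=
    (continuous_dPotential hU hV 1 0).comp (continuous_pi fun _ => hyc)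
  have hφc : Continuous φ := hy''c.add hPc
  refine ⟨φ, hφc, z, hzc, ?_, ?_⟩
  · rw [isIntegralSolutionOn_chain_iff hU hV hzc]
    refine ⟨fun t ht i => ?_, fun t ht i => ?_⟩
    · have hi : i = 0 := Subsingleton.elim i 0
      subst hi
      simp only [hz, chainForcing_fst]
      rw [integral_deriv_of_two hy, hy0]
      ring
    · have hi : i = 0 := Subsingleton.elim i 0
      subst hi
      simp only [hz, chainForcing_snd_zero]
      rw [intervalIntegral.integral_add (hy''c.intervalIntegrable _ _) (hPc.intervalIntegrable _ _),
        integral_deriv_deriv_of_two hy, hy0']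
      ring
  · have hzT : z T = xT := by
      refine Prod.ext (funext fun i => ?_) (funext fun i => ?_)
      · have hi : i = 0 := Subsingleton.elim i 0
        subst hi; simp [hz, hyT]
      · have hi : i = 0 := Subsingleton.elim i 0
        subst hi; simp [hz, hyT']
    rw [hzT, dist_self]
    exact hε.le

/-- A component of a phase-space vector is bounded by its norm. [folklore] -/
theorem abs_fst_apply_le_norm {m : ℕ} (z : PhaseSpace m) (i : Fin m) : |z.1 i| ≤ ‖z‖ :=
  (Real.norm_eq_abs _ ▸ norm_le_pi_norm z.1 i).trans (norm_fst_le z)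

/-- A component of a phase-space vector is bounded by its norm. [folklore] -/
theorem abs_snd_apply_le_norm {m : ℕ} (z : PhaseSpace m) (i : Fin m) : |z.2 i| ≤ ‖z‖ :=
  (Real.norm_eq_abs _ ▸ norm_le_pi_norm z.2 i).trans (norm_snd_le z)

/-- **The induction step: peeling the end site.** If chains with `m + 1` sites are approximately
controllable by a force on site `0`, so are chains with `m + 2` sites: steer the tail by the
induction hypothesis with a force profile `φ₁`; by robustness any profile `δ`-close in the
primitive does as well; realise such a profile as the bond force `-V'(y)`, `y = q_1 - q_0`, with
`y ∈ C²` having the end jets dictated by the initial and target states (`ForceTracking.lean`); then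
the end site `q_0 = q_1 - y` obeys its own equation with the continuous force
`φ = ṗ_0 + ∂_0Φ(q)`. [cite: ReyBelletThomas2002, Prop 4.2] -/
theorem chain_approxControl_succ (hU : ContDiff ℝ 2 P.U) (hV : ContDiff ℝ 2 P.V)
    (hVs : Function.Surjective (deriv P.V)) (m : ℕ)
    (ih : ∀ {T : ℝ}, 0 < T → ∀ (x₀ xT : PhaseSpace (m + 1)) {ε : ℝ}, 0 < ε →
      ∃ φ : ℝ → ℝ, Continuous φ ∧ ∃ z : ℝ → PhaseSpace (m + 1), Continuous z ∧
        IsIntegralSolutionOn (P.chainField (m + 1)) (chainForcing m x₀ φ) z T ∧ dist (z T) xT ≤ ε)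
    {T : ℝ} (hT : 0 < T) (x₀ xT : PhaseSpace (m + 2)) {ε : ℝ} (hε : 0 < ε) :
    ∃ φ : ℝ → ℝ, Continuous φ ∧ ∃ z : ℝ → PhaseSpace (m + 2), Continuous z ∧
      IsIntegralSolutionOn (P.chainField (m + 2)) (chainForcing (m + 1) x₀ φ) z T ∧
        dist (z T) xT ≤ ε := by
  -- data of the end site and of the tail
  set x₀' : PhaseSpace (m + 1) := tailPS x₀ with hx₀'
  set xT' : PhaseSpace (m + 1) := tailPS xT with hxT'
  -- 1. steer the tail
  obtain ⟨φ₁, hφ₁c, z₁, hz₁c, hz₁, hdist₁⟩ := ih hT x₀' xT' (half_pos hε)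
  -- 2. robustness of the tail trajectory
  obtain ⟨δ, hδ, hrob⟩ := hz₁.exists_near_of_forcing (contDiff_chainField hU hV (m + 1)) hz₁c
    (half_pos hε)
  -- 3. track the required force through the bond `(0, 1)`
  set w : ℝ → ℝ := fun r => -deriv P.V r with hw
  have hV' : Continuous (deriv P.V) := continuous_deriv_of_two hV
  have hwc : Continuous w := hV'.neg
  have hws : Function.Surjective w := fun c => by
    obtain ⟨r, hr⟩ := hVs (-c)
    exact ⟨r, by simp [hw, hr]⟩
  obtain ⟨y, hy, hy0, hy0', hyT, hyT', htrack⟩ := exists_contDiff_forceTracking' hwc hws hT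
    (hφ₁c.continuousOn) (x₀'.1 0 - x₀.1 0) (x₀'.2 0 - x₀.2 0) (xT'.1 0 - xT.1 0)
    (xT'.2 0 - xT.2 0) hδ
  have hyc : Continuous y := hy.continuous
  have hy'c : Continuous (deriv y) := (contDiff_one_deriv_of_two hy).continuous
  have hy''c : Continuous (deriv (deriv y)) := continuous_deriv_deriv_of_two hy
  -- 4. the perturbed tail forcing (the actual bond force) and its trajectory
  set ψ : ℝ → ℝ := fun s => w (y s) with hψ
  have hψc : Continuous ψ := hwc.comp hyc
  have hpert : ∀ t ∈ Icc 0 T, ‖chainForcing m x₀' ψ t - chainForcing m x₀' φ₁ t‖ ≤ δ := by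
    intro t ht
    rw [norm_chainForcing_sub, ← intervalIntegral.integral_sub (hψc.intervalIntegrable _ _)
      (hφ₁c.intervalIntegrable _ _)]
    exact htrack t ht
  obtain ⟨z₂, hz₂c, hz₂, hclose⟩ := hrob (chainForcing m x₀' ψ) (continuous_chainForcing m x₀' hψc)
    hpert
  obtain ⟨hq₂, hp₂⟩ := (isIntegralSolutionOn_chain_iff hU hV hz₂c).1 hz₂
  -- 5. the full trajectory and its force
  set q₀ : ℝ → ℝ := fun t => (z₂ t).1 0 - y t with hq₀
  set p₀ : ℝ → ℝ := fun t => (z₂ t).2 0 - deriv y t with hp₀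
  set z : ℝ → PhaseSpace (m + 2) := fun t => consPS (q₀ t, p₀ t) (z₂ t) with hz
  have hq₀c : Continuous q₀ :=
    ((continuous_apply 0).comp (continuous_fst.comp hz₂c)).sub hyc
  have hp₀c : Continuous p₀ :=
    ((continuous_apply 0).comp (continuous_snd.comp hz₂c)).sub hy'c
  have hzc : Continuous z := continuous_consPS (hq₀c.prodMk hp₀c) hz₂c
  have hz1 : ∀ t, (z t).1 = Fin.cons (q₀ t) (z₂ t).1 := fun t => rfl
  have hA : Continuous fun t => P.dPotential (m + 1) 0 (z₂ t).1 :=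
    (continuous_dPotential hU hV (m + 1) 0).comp (continuous_fst.comp hz₂c)
  have hB : Continuous fun t => P.dPotential (m + 2) 0 (z t).1 :=
    (continuous_dPotential hU hV (m + 2) 0).comp (continuous_fst.comp hzc)
  set φ : ℝ → ℝ := fun t =>
    ψ t - P.dPotential (m + 1) 0 (z₂ t).1 - deriv (deriv y) t + P.dPotential (m + 2) 0 (z t).1
    with hφ
  have hφc : Continuous φ := ((hψc.sub hA).sub hy''c).add hB
  refine ⟨φ, hφc, z, hzc, ?_, ?_⟩
  · -- the integral equations, componentwise
    rw [isIntegralSolutionOn_chain_iff hU hV hzc]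
    refine ⟨fun t ht i => ?_, fun t ht i => ?_⟩
    · -- positions
      refine Fin.cases ?_ (fun j => ?_) i
      · -- the end site
        show q₀ t = (chainForcing (m + 1) x₀ φ t).1 0 + ∫ s in (0 : ℝ)..t, p₀ s
        rw [chainForcing_fst]
        simp only [hq₀, hp₀]
        have hc0 : Continuous fun s => (z₂ s).2 0 :=
          (continuous_apply 0).comp (continuous_snd.comp hz₂c)
        rw [intervalIntegral.integral_sub (hc0.intervalIntegrable _ _)
          (hy'c.intervalIntegrable _ _), integral_deriv_of_two hy, hq₂ t ht 0, chainForcing_fst,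
          hy0]
        simp only [hx₀', tailPS_fst, Fin.succ_zero_eq_one]
        ring
      · -- the tail
        show (z₂ t).1 j = (chainForcing (m + 1) x₀ φ t).1 j.succ + ∫ s in (0 : ℝ)..t, (z₂ s).2 j
        rw [hq₂ t ht j, chainForcing_fst, chainForcing_fst]
        simp [hx₀']
    · -- momenta
      refine Fin.cases ?_ (fun j => ?_) i
      · -- the end site
        show p₀ t = (chainForcing (m + 1) x₀ φ t).2 0 -
          ∫ s in (0 : ℝ)..t, P.dPotential (m + 2) 0 (z s).1
        rw [chainForcing_snd_zero]
        simp only [hp₀]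
        have hsplit : ∫ s in (0 : ℝ)..t, φ s = (∫ s in (0 : ℝ)..t, ψ s) -
            (∫ s in (0 : ℝ)..t, P.dPotential (m + 1) 0 (z₂ s).1) -
            (∫ s in (0 : ℝ)..t, deriv (deriv y) s) +
            ∫ s in (0 : ℝ)..t, P.dPotential (m + 2) 0 (z s).1 := by
          simp only [hφ]
          have h2 : Continuous fun s => ψ s - P.dPotential (m + 1) 0 (z₂ s).1 := hψc.sub hA
          have h3 : Continuous fun s => ψ s - P.dPotential (m + 1) 0 (z₂ s).1 - deriv (deriv y) s :=
            h2.sub hy''c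
          rw [intervalIntegral.integral_add (h3.intervalIntegrable _ _) (hB.intervalIntegrable _ _),
            intervalIntegral.integral_sub (h2.intervalIntegrable _ _) (hy''c.intervalIntegrable _ _),
            intervalIntegral.integral_sub (hψc.intervalIntegrable _ _) (hA.intervalIntegrable _ _)]
        rw [hsplit, integral_deriv_deriv_of_two hy, hp₂ t ht 0, chainForcing_snd_zero, hy0']
        simp only [hx₀', tailPS_snd, Fin.succ_zero_eq_one]
        ring
      · -- the tail
        show (z₂ t).2 j = (chainForcing (m + 1) x₀ φ t).2 j.succ -
          ∫ s in (0 : ℝ)..t, P.dPotential (m + 2) j.succ (z s).1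
        rw [chainForcing_snd_of_ne_zero _ _ _ _ (Fin.succ_ne_zero j), hp₂ t ht j]
        simp only [hz1, P.dPotential_cons_succ]
        by_cases hj : j.val = 0
        · have hj' : j = 0 := Fin.ext hj
          subst hj'
          simp only [Fin.val_zero, if_true, chainForcing_snd_zero]
          have hyq : ∀ s, (z₂ s).1 0 - q₀ s = y s := fun s => by simp [hq₀]
          simp only [hyq]
          have hVy : Continuous fun s => deriv P.V (y s) := hV'.comp hyc
          rw [intervalIntegral.integral_add (hA.intervalIntegrable _ _) (hVy.intervalIntegrable _ _)]
          have hψint : ∫ s in (0 : ℝ)..t, ψ s = -∫ s in (0 : ℝ)..t, deriv P.V (y s) := by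
            rw [← intervalIntegral.integral_neg]
          rw [hψint]
          simp only [hx₀', tailPS_snd, Fin.succ_zero_eq_one]
          ring
        · have hj' : j ≠ 0 := fun h => hj (by rw [h]; rfl)
          simp only [hj, if_false, add_zero]
          rw [chainForcing_snd_of_ne_zero _ _ _ _ hj']
          simp [hx₀']
  · -- the endpoint
    have hzT : dist (z₂ T) xT' ≤ ε := by
      calc dist (z₂ T) xT' ≤ dist (z₂ T) (z₁ T) + dist (z₁ T) xT' := dist_triangle _ _ _
        _ ≤ ε / 2 + ε / 2 :=
            add_le_add (by rw [dist_eq_norm]; exact hclose T ⟨hT.le, le_rfl⟩) hdist₁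
        _ = ε := by ring
    rw [← consPS_tailPS xT]
    refine dist_consPS_le hε.le ?_ ?_ hzT
    · show |q₀ T - xT.1 0| ≤ ε
      have h : q₀ T - xT.1 0 = (z₂ T - xT').1 0 := by
        simp only [hq₀, hyT, Prod.fst_sub, Pi.sub_apply]; ring
      rw [h]
      exact (abs_fst_apply_le_norm _ 0).trans (by rw [← dist_eq_norm]; exact hzT)
    · show |p₀ T - xT.2 0| ≤ ε
      have h : p₀ T - xT.2 0 = (z₂ T - xT').2 0 := by
        simp only [hp₀, hyT', Prod.snd_sub, Pi.sub_apply]; ring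
      rw [h]
      exact (abs_snd_apply_le_norm _ 0).trans (by rw [← dist_eq_norm]; exact hzT)

/-- **Approximate controllability of the anharmonic chain by one force at its end**
(Rey-Bellet–Thomas 2002, Prop. 4.2; Eckmann–Pillet–Rey-Bellet 1999, Thm 3.2 — here for `V'`
merely ONTO). For `U, V ∈ C²` with `deriv V` surjective, every number of sites `m + 1`, every
`T > 0`, all `x₀, x_T ∈ PhaseSpace (m + 1)` and `ε > 0`, there are a continuous force profile
`φ` on site `0` and a continuous solution `z` on `[0, T]` of the forced chain
`z(t) = x₀ + (∫₀ᵗ φ)(0, e_0) + ∫₀ᵗ X_H(z)` with `dist (z T) x_T ≤ ε`.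
[cite: ReyBelletThomas2002, Prop 4.2] -/
theorem chain_approxControl (hU : ContDiff ℝ 2 P.U) (hV : ContDiff ℝ 2 P.V)
    (hVs : Function.Surjective (deriv P.V)) (m : ℕ) {T : ℝ} (hT : 0 < T)
    (x₀ xT : PhaseSpace (m + 1)) {ε : ℝ} (hε : 0 < ε) :
    ∃ φ : ℝ → ℝ, Continuous φ ∧ ∃ z : ℝ → PhaseSpace (m + 1), Continuous z ∧
      IsIntegralSolutionOn (P.chainField (m + 1)) (chainForcing m x₀ φ) z T ∧ dist (z T) xT ≤ ε := by
  induction m generalizing T ε with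
  | zero => exact chain_approxControl_zero hU hV hT x₀ xT hε
  | succ m ih =>
    exact chain_approxControl_succ hU hV hVs m (fun hT' x₀' xT' _ hε' => ih hT' x₀' xT' hε') hT
      x₀ xT hε

end OscillatorChain

end Literature.MathematicalPhysics.KineticTheory.HeatConduction

end
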